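import Summits.ResolutionOfSingularities.ResolutionOfSingularities.Theorems.FrobeniusLadderFInjectiveMacaulayficationPointFixOfRegularGenerizations
import Literature.AlgebraicGeometry.Resolution.Temkin2008LocalizationProofs
import Literature.AlgebraicGeometry.Resolution.BlowupStalkCharts
import Literature.AlgebraicGeometry.Resolution.BlowupsIntegral
import Literature.AlgebraicGeometry.Resolution.BlowupsScaling
import Literature.AlgebraicGeometry.Resolution.BirationalDimensionInequality
import Literature.AlgebraicGeometry.Resolution.KollarBlowupSequenceFunctors
import Literature.AlgebraicGeometry.Resolution.AlterationsStrong
import Literature.AlgebraicGeometry.Resolution.AlterationsNormalFormBlowup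
import Literature.AlgebraicGeometry.Dimension.FibreLocalRingDimension
import HarnessLib

/-!
# LINE U, (U1) `RegularOffCodimFourResidue` for INTEGRAL `X`: regular off the preimage of the points of local dimension ≥ 4
# = Temkin 2008 Prop. 2.3.4 («localization of desingularization») TRUNCATED AT CODIMENSION 4, with the local input supplied by
# Cossart–Piltant 2019 at dimension-3 points (crux `FInjectiveMacaulayfication` stmt-ResolutionOfSingularities-15315, chain w45a;
# res-L1-w45a-plan-1 R15.26 (2) / R15.27 (2) «stub-3 := R-U1: ONE file … = U1 as a patch of `temkin2008_prop234_of_comp`»;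
# typed target = res-L1-w45a-strat-1 `ULine.lean` v1.5 a49f5b3dbd3e00e6 `RegularOffCodimFourResidue`; seat res-L1-w45a-stub-3)

[OURS · L1 W4.5a] Support file (`--supports stmt-ResolutionOfSingularities-15315 --as helper`); NOT a statement of any manuscript; AI-written
(AI review is weaker than expert review). CONDITIONAL on the three named facts of the tree's threefold package, BY NAME:
`CossartPiltant2019General`, `Stacks081R`, `CossartPiltant2019Principalization`.

THE THEOREM (`exists_isBlowup_regular_off_codimFour`, blow-up currency). `X` an INTEGRAL scheme of finite type over a field `k` with
`3 ≤ dim X`. Then there are a blowing up `f : X' → X` along an ideal sheaf `J` with `Supp J ⊆ Sing X` and a closed set `B ⊆ X` all of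
whose points have local rings of dimension `≥ 4`, such that `X'` is regular off `f⁻¹(B)`. (`dim X ≤ 2`: Cossart–Piltant's printed
theorem resolves `X` outright — `regularOffCodimFourResidue_of_isIntegral` covers both cases in the PROPER currency of strat-1's U1.)

PROOF = the Noetherian induction of `Literature.AlgebraicGeometry.Resolution.temkin2008_prop234_of_comp` (Temkin 2008, Prop. 2.3.4,
arXiv p. 12) on the closed set `C ⊆ Sing X` over which `X'` may still be singular, with two changes: (a) STOP when every point of `C`
has local dimension `≥ 4` (then `B := C`); (b) otherwise some `c ∈ C` has `dim 𝒪_{X,c} ≤ 3`; choose a specialisation `x ∈ closure {c}`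
with `dim 𝒪_{X,x} = 3` EXACTLY (`exists_specializes_ringKrullDim_stalk_eq`: the dimension formula `dim 𝒪_{X,y} + dim closure {y} = dim X`
of the tree, `coheight_add_height_eq_topologicalKrullDim`, along a maximal chain of specialisations of `c`), and run the printed local step
at `x` WITHOUT any maximality: the pro-open local scheme `Z = X' ×_X Spec 𝒪_{X,x}` is an integral Noetherian separated quasi-excellent
scheme of dimension `3` (a blowing up of `Spec 𝒪_{X,x}`), so Cossart–Piltant (`CP2019.exists_isBlowup_isRegular_of_dim_three_of_isQuasiExcellent`)
blows it up to a REGULAR `T` along `𝓘` with `Supp 𝓘 ⊆ Sing Z` — these points lie over `C` —; extend `𝓘` to `X'` by closure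
(`exists_idealSheaf_extension_fromSpecStalk`, Temkin Lemma 2.1.1), blow up, compose (`IsBlowup.exists_isBlowup_comp_supported`, Lemma
2.1.4); the new bad set `C'` is closed (properness), `C' ⊆ C`, and `C'` misses EVERY generization of `x` (over them the new scheme is
`T`, by flat base change and uniqueness of blowing up), in particular `c`: `C' < C`.

COROLLARY `regularOffCodimFourResidue_of_isIntegral` = strat-1's `UReduction.RegularOffCodimFourResidue` text (proper birational
reduced `X₂`, closed `B` of local dimension ≥ 4, regular off `B`) restricted to `IsIntegral X` in place of `IsReduced X`; the reduced
case (component separation) is not treated here. [folklore assembly; cite: Temkin2008, Prop. 2.3.4; CossartPiltant2019, Thm. 1.1;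
StacksProject, Tag 080B and Tag 01J7]
-/

-- single-problem summit: the doubled namespace component is forced
set_option linter.dupNamespace false

noncomputable section

open CategoryTheory CategoryTheory.Limits AlgebraicGeometry TopologicalSpace IsLocalRing Order
open Literature.AlgebraicGeometry.Resolution Literature.AlgebraicGeometry.CossartPiltant200819

namespace Summit.ResolutionOfSingularities.ResolutionOfSingularities.Theorems.FInjectiveMacaulayfication.RegularOffCodimFourResidue

open Summit.ResolutionOfSingularities.ResolutionOfSingularities.Theorems.FInjectiveMacaulayfication

/-! ## §1 Dimension stepping along specialisations -/

/-- **A point of local dimension `≤ n` specialises to a point of local dimension exactly `n ≤ dim X`** (`X` integral, of finite type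
over a field): along a maximal chain of specialisations of `c` the local dimension climbs by one at each step, by the dimension
formula `dim 𝒪_{X,y} + dim closure {y} = dim X` (`coheight_add_height_eq_topologicalKrullDim`). [folklore; cite: GortzWedhorn2020, Thm. 5.22] -/
theorem exists_specializes_ringKrullDim_stalk_eq {K : Type} [Field K] {X : Scheme.{0}} [IsIntegral X] (f : X ⟶ Spec (.of K))
    [LocallyOfFiniteType f] {d : ℕ} (hd : topologicalKrullDim X = d) (c : X) {n : ℕ}
    (hcn : ringKrullDim (X.presheaf.stalk c) ≤ n) (hnd : n ≤ d) :
    ∃ x : X, c ⤳ x ∧ ringKrullDim (X.presheaf.stalk x) = n := by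
  have hform := Literature.AlgebraicGeometry.Dimension.coheight_add_height_eq_topologicalKrullDim f c
  rw [hd] at hform
  have hform' : coheight c + height c = d := by exact_mod_cast hform
  -- `height c` and `coheight c` are finite
  have hh : height c ≠ ⊤ := by
    intro h
    rw [h, add_top] at hform'
    exact ENat.coe_ne_top d hform'.symm
  have hch : coheight c ≠ ⊤ := by
    intro h
    rw [h, top_add] at hform'
    exact ENat.coe_ne_top d hform'.symm
  obtain ⟨h, hh'⟩ := ENat.ne_top_iff_exists.mp hh
  obtain ⟨e, he'⟩ := ENat.ne_top_iff_exists.mp hch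
  rw [← hh', ← he'] at hform'
  have hsum : e + h = d := by exact_mod_cast hform'
  -- `dim 𝒪_c = coheight c = e ≤ n`
  have hen : e ≤ n := by
    have h1 : ringKrullDim (X.presheaf.stalk c) = (e : ℕ∞) := by
      rw [ringKrullDim_stalk_eq_coheight, ← he']
    rw [h1] at hcn
    exact_mod_cast hcn
  -- a maximal chain of specialisations of `c`, and its element of height `d - n`
  obtain ⟨p, hlast, hlen⟩ := Order.exists_series_of_le_height c (n := h) (by rw [← hh'])
  have hi : d - n ≤ p.length := by rw [hlen]; omega
  let i : Fin (p.length + 1) := ⟨d - n, Nat.lt_succ_of_le hi⟩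
  refine ⟨p i, ?_, ?_⟩
  · -- `p i ≤ p.last = c`, i.e. `c ⤳ p i`
    have hle : p i ≤ p.last := by
      rw [RelSeries.last]
      exact p.monotone (Fin.le_last i)
    rw [hlast] at hle
    exact Scheme.le_iff_specializes.mp hle
  · -- `height (p i) = d - n`, so `coheight (p i) = n`
    have hht : height (p i) = ((d - n : ℕ) : ℕ∞) := by
      have := Order.height_eq_index_of_length_eq_height_last (p := p) (by rw [hlast, ← hh', hlen]) i
      rw [this]
    have hformi := Literature.AlgebraicGeometry.Dimension.coheight_add_height_eq_topologicalKrullDim f (p i)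
    rw [hd] at hformi
    have hformi' : coheight (p i) + height (p i) = d := by exact_mod_cast hformi
    rw [hht] at hformi'
    have hci : coheight (p i) = (n : ℕ∞) := by
      have hne : coheight (p i) ≠ ⊤ := by
        intro h0
        rw [h0, top_add] at hformi'
        exact ENat.coe_ne_top d hformi'.symm
      obtain ⟨m, hm⟩ := ENat.ne_top_iff_exists.mp hne
      rw [← hm] at hformi' ⊢
      have : m + (d - n) = d := by exact_mod_cast hformi'
      have : m = n := by omega
      rw [this]
    rw [ringKrullDim_stalk_eq_coheight, hci]
    rfl

/-! ## §2 The truncated Noetherian induction -/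

/-- **(U1) FOR INTEGRAL `X` OF DIMENSION `≥ 3`, BLOW-UP CURRENCY** — see the module docstring. [folklore assembly, adapted from
`Literature.AlgebraicGeometry.Resolution.temkin2008_prop234_of_comp`; cite: Temkin2008, Prop. 2.3.4; CossartPiltant2019, Thm. 1.1;
StacksProject, Tag 080B] -/
theorem exists_isBlowup_regular_off_codimFour
    (hG : CossartPiltant2019General.{0}) (h081R : Stacks081R.{0}) (hP : CossartPiltant2019Principalization.{0})
    {k : Type} [Field k] {X : Scheme.{0}} (f₀ : X ⟶ Spec (.of k)) [IsIntegral X] [LocallyOfFiniteType f₀] [QuasiCompact f₀]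
    (h3 : (3 : WithBot ℕ∞) ≤ topologicalKrullDim X) :
    ∃ (X' : Scheme.{0}) (f : X' ⟶ X) (J : X.IdealSheafData), IsBlowup f J ∧
      (J.support : Set X) ⊆ (Scheme.regularLocus X)ᶜ ∧
      ∃ B : Set X, IsClosed B ∧ (∀ b ∈ B, (4 : WithBot ℕ∞) ≤ ringKrullDim (X.presheaf.stalk b)) ∧
        ∀ x' : X', f x' ∉ B → IsRegularLocalRing (X'.presheaf.stalk x') := by
  classical
  have hk : Scheme.IsQuasiExcellent (Spec (.of k)) :=
    Scheme.isQuasiExcellent_of_locallyOfFiniteType Stacks07QW_field_holds (𝟙 (Spec (.of k)))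
  -- `X` is a Noetherian scheme of some dimension `d ≥ 3`; its singular locus `T` is closed
  haveI : IsLocallyNoetherian X := LocallyOfFiniteType.isLocallyNoetherian f₀
  haveI : CompactSpace X := QuasiCompact.compactSpace_of_compactSpace f₀
  haveI : IsNoetherian X := {}
  obtain ⟨d₀, hd₀⟩ := exists_topologicalKrullDim_le_of_locallyOfFiniteType f₀
  obtain ⟨d, hd⟩ := exists_topologicalKrullDim_eq_nat hd₀
  have h3d : 3 ≤ d := by
    rw [hd] at h3
    exact_mod_cast h3
  set T : Set X := (Scheme.regularLocus X)ᶜ with hT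
  have hTc : IsClosed T := isClosed_compl_regularLocus_of_locallyOfFiniteType f₀ hk
  -- the induction statement
  suffices H : ∀ C : Closeds X, (C : Set X) ⊆ T →
      (∃ (X' : Scheme.{0}) (f : X' ⟶ X) (J : X.IdealSheafData), IsBlowup f J ∧
        (J.support : Set X) ⊆ T ∧ ∀ x' : X', f x' ∉ C → x' ∈ Scheme.regularLocus X') →
      ∃ (X' : Scheme.{0}) (f : X' ⟶ X) (J : X.IdealSheafData), IsBlowup f J ∧
        (J.support : Set X) ⊆ (Scheme.regularLocus X)ᶜ ∧
        ∃ B : Set X, IsClosed B ∧ (∀ b ∈ B, (4 : WithBot ℕ∞) ≤ ringKrullDim (X.presheaf.stalk b)) ∧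
          ∀ x' : X', f x' ∉ B → IsRegularLocalRing (X'.presheaf.stalk x') by
    refine H ⟨T, hTc⟩ subset_rfl ⟨X, 𝟙 X, ⊤, isBlowup_id_top X, ?_, fun x' hx' => ?_⟩
    · simp [Scheme.IdealSheafData.support_top]
    · simpa [hT] using hx'
  intro C
  induction C using WellFoundedLT.induction with
  | ind C ih =>
  intro hCT ⟨X', f, J, hf, hJ, hreg⟩
  -- (a) STOP: every point of `C` has local dimension `≥ 4`
  by_cases hall : ∀ c ∈ (C : Set X), (4 : WithBot ℕ∞) ≤ ringKrullDim (X.presheaf.stalk c)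
  · exact ⟨X', f, J, hf, hJ, C, C.isClosed, hall, fun x' hx' => (Scheme.mem_regularLocus x').mp (hreg x' hx')⟩
  -- (b) otherwise a point `c ∈ C` of local dimension `≤ 3`, and a specialisation `x` of `c` of local dimension `3`
  push Not at hall
  obtain ⟨c, hcC, hc4⟩ := hall
  obtain ⟨n, hn⟩ := Literature.AlgebraicGeometry.Resolution.exists_nat_cast_eq_ringKrullDim (R := X.presheaf.stalk c)
  have hn3 : n ≤ 3 := by
    rw [hn] at hc4
    have : (n : WithBot ℕ∞) < (4 : ℕ) := hc4
    have : n < 4 := by exact_mod_cast this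
    omega
  obtain ⟨x, hcx, hx3⟩ := exists_specializes_ringKrullDim_stalk_eq f₀ hd c (n := 3) (by rw [hn]; exact_mod_cast hn3) h3d
  have hxC : x ∈ (C : Set X) := C.isClosed.closure_subset_iff.mpr (Set.singleton_subset_iff.mpr hcC)
    (hcx.mem_closure)
  -- `X'` is Noetherian, integral, of finite type over `k`
  haveI : IsProper f := hf.isProper
  haveI : IsLocallyNoetherian X' := LocallyOfFiniteType.isLocallyNoetherian f
  haveI : CompactSpace X' := QuasiCompact.compactSpace_of_compactSpace f
  haveI : IsNoetherian X' := {}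
  have hJne : J ≠ ⊥ := by
    intro h0
    have hgen : genericPoint X ∈ (J.support : Set X) := by rw [h0, Scheme.IdealSheafData.support_bot]; trivial
    have : genericPoint X ∈ T := hJ hgen
    rw [hT, Set.mem_compl_iff, Scheme.mem_regularLocus] at this
    exact this (inferInstanceAs (IsRegularLocalRing X.functionField))
  haveI : IsIntegral X' := hf.isIntegral hJne
  -- the local scheme `S = Spec 𝒪_{X,x}` and the pro-open pro-subscheme `Z = X' ×_X S` of `X'`
  haveI : Flat (X.fromSpecStalk x) := flat_fromSpecStalk X x
  haveI : IsNoetherian (pullback f (X.fromSpecStalk x)) := {}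
  have hgb : IsBlowup (pullback.snd f (X.fromSpecStalk x)) (J.comap (X.fromSpecStalk x)) :=
    hf.pullback_snd_of_flat (X.fromSpecStalk x)
  have hfj : ∀ s : ↑(pullback f (X.fromSpecStalk x)),
      f (pullback.fst f (X.fromSpecStalk x) s) =
        X.fromSpecStalk x (pullback.snd f (X.fromSpecStalk x) s) := fun s => by
    rw [← Scheme.Hom.comp_apply, pullback.condition, Scheme.Hom.comp_apply]
  -- `Z` is integral, separated, quasi-excellent, of dimension `3`
  have hJx : J.comap (X.fromSpecStalk x) ≠ ⊥ := by
    rw [comap_fromSpecStalk_eq_affineBlowupIdealSheaf]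
    exact affineBlowup.idealSheaf_ne_bot (stalkIdeal_ne_bot_of_ne_bot hJne x)
  haveI : IsIntegral (pullback f (X.fromSpecStalk x)) := hgb.isIntegral hJx
  haveI : IsProper (pullback.snd f (X.fromSpecStalk x)) := hgb.isProper
  haveI : (pullback f (X.fromSpecStalk x)).IsSeparated :=
    Scheme.isSeparated_of_isSeparated_over (pullback.snd f (X.fromSpecStalk x))
  have hqeZ : Scheme.IsQuasiExcellent (pullback f (X.fromSpecStalk x)) :=
    Scheme.isQuasiExcellent_of_locallyOfFiniteType_of_isQuasiExcellentRing Stacks07QU_holds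
      ((Scheme.isQuasiExcellent_of_locallyOfFiniteType Stacks07QW_field_holds f₀).isQuasiExcellentRing_stalk x)
      (pullback.snd f (X.fromSpecStalk x))
  have hdimZ : topologicalKrullDim ↑(pullback f (X.fromSpecStalk x)) = 3 := by
    rw [(hgb.isBirational' hJx).topologicalKrullDim_eq_of_isProper]
    have h := PrimeSpectrum.topologicalKrullDim_eq_ringKrullDim (R := X.presheaf.stalk x)
    rw [hx3] at h
    exact h
  -- Cossart–Piltant on `Z`: a regular blowing up `ρ : T' → Z` along `𝓘` with `Supp 𝓘 ⊆ Sing Z`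
  obtain ⟨I', T', ρ, -, hρ, hT'reg, U, hU, hI'supp, -⟩ :=
    CP2019.exists_isBlowup_isRegular_of_dim_three_of_isQuasiExcellent hG h081R hP hqeZ hdimZ
  have hI'sing : ∀ s ∈ (I'.support : Set ↑(pullback f (X.fromSpecStalk x))),
      s ∉ Scheme.regularLocus (pullback f (X.fromSpecStalk x)) := fun s hs h => by
    have : s ∈ (U : Set _) := by rw [hU]; exact h
    exact hI'supp hs this
  -- extend the centre to `X'` (Lemma 2.1.1) and blow `X'` up along the extension
  obtain ⟨J', hJ'I', hJ'supp⟩ := exists_idealSheaf_extension_fromSpecStalk f x I'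
  obtain ⟨X'', f', hf'⟩ := exists_isBlowup X' J'
  -- the new centre lies over `C ⊆ T`: a singular point of `Z` is singular in `X'`, hence lies over `C`
  have hIC : ∀ s ∈ (I'.support : Set ↑(pullback f (X.fromSpecStalk x))),
      f (pullback.fst f (X.fromSpecStalk x) s) ∈ (C : Set X) := fun s hs => by
    by_contra h
    exact hI'sing s hs ((mem_regularLocus_iff_pullback_fst_fromSpecStalk f x s).mpr (hreg _ h))
  have hJ'C : f '' (J'.support : Set X') ⊆ (C : Set X) := by
    rw [hJ'supp]
    refine (image_closure_subset_closure_image f.continuous).trans ?_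
    refine C.isClosed.closure_subset_iff.mpr ?_
    rintro _ ⟨_, ⟨s, hs, rfl⟩, rfl⟩
    exact hIC s hs
  have hJ'T : (J'.support : Set X') ⊆ f ⁻¹' T := fun x' hx' => hCT (hJ'C ⟨x', hx', rfl⟩)
  -- so the composite is a `T`-supported blow-up of `X` (Lemma 2.1.4)
  obtain ⟨J₂, hf₂, hJ₂⟩ := hf.exists_isBlowup_comp_supported f J f' J' T hJ hf' hJ'T
  -- `X''` is of finite type over `k`: its singular locus is closed, with closed image `C'`
  haveI : IsProper f' := hf'.isProper
  have hreg'' : IsClosed (Scheme.regularLocus X'')ᶜ :=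
    isClosed_compl_regularLocus_of_locallyOfFiniteType ((f' ≫ f) ≫ f₀) hk
  let C' : Closeds X :=
    ⟨(f' ≫ f) '' (Scheme.regularLocus X'')ᶜ, (f' ≫ f).isClosedMap _ hreg''⟩
  -- `C' ⊆ C ∖ {generizations of x}`
  have hC'C : (C' : Set X) ⊆ (C : Set X) \ {y | y ⤳ x} := by
    rintro _ ⟨x'', hx'', rfl⟩
    refine ⟨?_, ?_⟩
    · -- over `X ∖ C`: `X'` is regular there and `f'` is an isomorphism off its centre
      by_contra hy
      have hy' : f (f' x'') ∉ (C : Set X) := by rwa [Scheme.Hom.comp_apply] at hy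
      have h1 : f' x'' ∈ Scheme.regularLocus X' := hreg _ hy'
      have h2 : f' x'' ∉ (J'.support : Set X') := fun h => hy' (hJ'C ⟨_, h, rfl⟩)
      haveI := hf'.isIso_compl
      exact hx'' ((mem_regularLocus_iff_of_isIso_morphismRestrict f'
        ⟨(J'.support : Set X')ᶜ, J'.support.isClosed.isOpen_compl⟩ x'' h2).mpr h1)
    · -- over the generizations of `x`: `X'' ×_{X'} Z` is the regular scheme `T'` (flat base change, uniqueness)
      intro hyx
      rw [Set.mem_setOf_eq, Scheme.Hom.comp_apply] at hyx
      have hs : f' x'' ∈ Set.range (pullback.fst f (X.fromSpecStalk x)) := by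
        rw [range_pullback_fst_fromSpecStalk]
        exact hyx
      have hT'' : IsBlowup (pullback.snd f' (pullback.fst f (X.fromSpecStalk x))) I' := by
        rw [← hJ'I']
        exact hf'.pullback_snd_of_flat _
      obtain ⟨e, -, -⟩ := hT''.unique hρ
      have hx''range : x'' ∈ Set.range (pullback.fst f' (pullback.fst f (X.fromSpecStalk x))) := by
        rw [Scheme.Pullback.range_fst]
        exact hs
      obtain ⟨t, rfl⟩ := hx''range
      apply hx''
      refine (mem_regularLocus_iff_of_flat_of_isPreimmersion _ t).mp ?_
      exact (mem_regularLocus_iff_of_flat_of_isPreimmersion e.hom t).mpr (hT'reg _)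
  have hlt : C' < C := by
    refine lt_of_le_of_ne (fun y hy => (hC'C hy).1) fun h => ?_
    have hc' : c ∈ (C' : Set X) := by
      rw [h]
      exact hcC
    exact (hC'C hc').2 hcx
  exact ih C' hlt (fun y hy => hCT (hC'C hy).1)
    ⟨X'', f' ≫ f, J₂, hf₂, hJ₂, fun x'' hx'' => by
      by_contra h
      exact hx'' ⟨x'', h, rfl⟩⟩

/-! ## §3 Strat-1's (U1) text for integral `X` (proper currency) -/

/-- **(U1) `RegularOffCodimFourResidue` FOR INTEGRAL `X`** — res-L1-w45a-strat-1's `UReduction.RegularOffCodimFourResidue` (ULine v1.5)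
VERBATIM with `IsIntegral X` in place of `IsReduced X`: every integral separated finite-type `k`-scheme has a proper birational
reduced (indeed integral) model `X₂ → X` regular off the preimage of a closed set of points of local dimension `≥ 4`. `dim X ≥ 3`:
the truncated Temkin induction `exists_isBlowup_regular_off_codimFour` (a blowing up); `dim X ≤ 2`: Cossart–Piltant's printed theorem
(`CossartPiltant2019General`) resolves `X` outright, `B = ∅`. The characteristic `p` plays no role. Modulo the three threefold named
facts. [folklore assembly; cite: Temkin2008, Prop. 2.3.4; CossartPiltant2019, Thm. 1.1] -/
theorem regularOffCodimFourResidue_of_isIntegral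
    (hG : CossartPiltant2019General.{0}) (h081R : Stacks081R.{0}) (hP : CossartPiltant2019Principalization.{0}) :
    ∀ p : ℕ, p.Prime → ∀ (k : Type) [Field k] [CharP k p] (X : Scheme.{0}) (f : X ⟶ Spec (.of k)),
    IsSeparated f → LocallyOfFiniteType f → QuasiCompact f → IsIntegral X →
    ∃ (X₂ : Scheme.{0}) (π₂ : X₂ ⟶ X), IsProper π₂ ∧ IsBirational π₂ ∧ IsReduced X₂ ∧
      ∃ B : Set X, IsClosed B ∧ (∀ b ∈ B, (4 : WithBot ℕ∞) ≤ ringKrullDim (X.presheaf.stalk b)) ∧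
        ∀ x₂ : X₂, π₂.base x₂ ∉ B → IsRegularLocalRing (X₂.presheaf.stalk x₂) := by
  intro p _ k _ _ X f hsep hft hqc hint
  haveI := hsep
  haveI := hft
  haveI := hqc
  haveI := hint
  haveI : IsLocallyNoetherian X := LocallyOfFiniteType.isLocallyNoetherian f
  haveI : CompactSpace X := QuasiCompact.compactSpace_of_compactSpace f
  haveI : IsNoetherian X := {}
  by_cases h3 : (3 : WithBot ℕ∞) ≤ topologicalKrullDim X
  · obtain ⟨X', f', J, hf', hJ, B, hB, hB4, hreg⟩ := exists_isBlowup_regular_off_codimFour hG h081R hP f h3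
    have hJne : J ≠ ⊥ := by
      intro h0
      have hgen : genericPoint X ∈ (J.support : Set X) := by rw [h0, Scheme.IdealSheafData.support_bot]; trivial
      have := hJ hgen
      rw [Set.mem_compl_iff, Scheme.mem_regularLocus] at this
      exact this (inferInstanceAs (IsRegularLocalRing X.functionField))
    haveI : IsIntegral X' := hf'.isIntegral hJne
    exact ⟨X', f', hf'.isProper, hf'.isBirational' hJne, inferInstance, B, hB, hB4, hreg⟩
  · -- `dim X ≤ 2`: Cossart–Piltant resolves `X`
    haveI : X.IsSeparated := Scheme.isSeparated_of_isSeparated_over f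
    have hqe : Scheme.IsQuasiExcellent X := Scheme.isQuasiExcellent_of_locallyOfFiniteType Stacks07QW_field_holds f
    have hdim : topologicalKrullDim X ≤ 3 := le_of_lt (lt_of_not_ge h3)
    obtain ⟨X', π, hπ, -, -, -⟩ := hG X hqe hdim
    exact ⟨X', π, hπ.isProper, hπ.isBirational, hπ.isRegular.isReduced, ∅, isClosed_empty, fun _ h => absurd h (Set.notMem_empty _),
      fun x' _ => hπ.isRegular x'⟩

end Summit.ResolutionOfSingularities.ResolutionOfSingularities.Theorems.FInjectiveMacaulayfication.RegularOffCodimFourResidue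

end
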